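import Summits.ValiantsHypothesis.ValiantsHypothesis.Theorems.KPlusLogSqLawTropicalBChainSplit
import Summits.ValiantsHypothesis.ValiantsHypothesis.Theorems.KPlusLogSqLawTropicalBBlockTriangular

/-!
# Route `KPlusLogSqLaw`, crux `TropicalB` — the VISITED-STATE ENGINE (dyadic recursion for a hereditary class)

HONEST FRAMING.  Helper file toward the registered stubs `stub_tropThin` / `stub_tropFat` of
`Cruxes/TropicalB/Lines/birth.lean` (crux `Summit.ValiantsHypothesis.ValiantsHypothesis.Theses.KPlusLogSqLaw.TropicalB`,
ledger item `stmt-ValiantsHypothesis-19771`, route `KPlusLogSqLaw`, DRAFT; cell `pub-symmetroid`, seat `val-sym-trop-p1`,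
2026-08-26).  Nothing here proves any part of a stub; nothing asserts `TropicalB`, `KPlusLogSqLaw`, `MatrixDescartes`
or anything about `VP ≠ VNP`.

WHAT IT IS.  The tribunal's reading of the crux after round 3 («the lift still needed is a VISITED-STATE bound») as one
reusable theorem.  Let `P` be a class of designs (a predicate per format), HEREDITARY under the two restrictions of the
column split at states that present terms actually use, and suppose every unsigned dominant chain of every design of `P` of
format `m ≥ 2` visits at most `S m` distinct first-block row sets at the balanced cut `c = m / 2` (VISITED-STATE BOUND).  If a
budget `G : ℕ → ℕ` satisfies `K ≤ G 0`, is monotone, and absorbs one level of the recursion,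
`S m · (2·G t + 1) ≤ G (t+1) + 1` for `2^t < m ≤ 2^(t+1)`, then every design of `P` of format `m ≤ 2^t` has unsigned row bound
`G t`:

* `designRowD_of_visitedStates` — the engine (proof: `chain_split` with the visited states as the state family, induction on `t`).

So a support class closes its instance of `TropicalB` as soon as `Σ_levels log₂ S(m/2^i) ≤ C·(K + log₂² m)`; the Hessenberg sector
(`S m = m/2 + 1`), the block-triangular sector (`S = 1` at block cuts) and banded sectors are instances, and for GENERAL supports the
crux is exactly the missing per-level bound `S m ≤ 2^{O((K + log² m)/log m)}` (a bound of the crux's own size `2^{C(K+log² m)}` per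
level would NOT suffice — the recursion multiplies the levels).  [folklore: Gusfield 1980 / Carstensen 1983 divide and conquer, in
the dominance vocabulary]
-/

set_option linter.dupNamespace false
set_option autoImplicit false

namespace Summit.ValiantsHypothesis.ValiantsHypothesis.Theorems.KPlusLogSqLaw

open Summit.ValiantsHypothesis.ValiantsHypothesis.Theorems.MatrixDescartes.Negative
open Summit.ValiantsHypothesis.ValiantsHypothesis.Theorems.LacunarySymmetroidMatrixDescartes
open Summit.ValiantsHypothesis.ValiantsHypothesis.Theorems.LacunarySymmetroidMatrixDescartes.TropicalCensus
open scoped BigOperators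
open Finset

section Engine

variable {K : ℕ}

/-- **The visited-state engine.**  `P` = a class of designs (per format), `S` = a visited-state bound at the balanced cut,
`G` = a budget absorbing one level of the dyadic recursion.  Hypotheses:
* `hcast`  — `P` is invariant under `Fin.cast` (re-typing the format);
* `hleft`  — heredity, first block: if a design of format `c + e` is in `P` and `R` is the first-block row set of some
  PRESENT term, the restriction to (rows of `R`, increasing `r`; first column block) is in `P`;
* `hright` — heredity, second block: same for (rows outside `R`, increasing; second column block);
* `hvisit` — visited-state bound: for a design of `P` of format `c + e` with `c = (c+e)/2`, `2 ≤ c + e`, every unsigned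
  dominant chain visits at most `S (c+e)` distinct first-block row sets;
* `hG0 : K ≤ G 0`, `hGmono : Monotone G`, `hGstep : 2^t < m ≤ 2^(t+1) → S m · (G t + G t + 1) ≤ G (t+1) + 1`.
Conclusion: every design of `P` of format `m ≤ 2^t` has `DesignRowD … (G t)`. [folklore] -/
theorem designRowD_of_visitedStates
    (P : (m : ℕ) → (Fin K → ℕ) → (Fin m → Fin m → Fin K → ℤ) → (Fin m → Fin m → Fin K → ℤ) → Prop)
    (S G : ℕ → ℕ)
    (hcast : ∀ (m m' : ℕ) (h : m' = m) (d : Fin K → ℕ) (v ε : Fin m → Fin m → Fin K → ℤ), P m d v ε →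
      P m' d (fun a b l => v (Fin.cast h a) (Fin.cast h b) l) (fun a b l => ε (Fin.cast h a) (Fin.cast h b) l))
    (hleft : ∀ (c e : ℕ) (d : Fin K → ℕ) (v ε : Fin (c + e) → Fin (c + e) → Fin K → ℤ), P (c + e) d v ε →
      ∀ (q : Equiv.Perm (Fin (c + e)) × (Fin (c + e) → Fin K)), termSign ε q ≠ 0 →
      ∀ r : Fin c ↪o Fin (c + e), (∀ i, r i ∈ (univ : Finset (Fin c)).image (fun j => q.1 (Fin.castAdd e j))) →
        P c d (fun i j l => v (r i) (Fin.castAdd e j) l) (fun i j l => ε (r i) (Fin.castAdd e j) l))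
    (hright : ∀ (c e : ℕ) (d : Fin K → ℕ) (v ε : Fin (c + e) → Fin (c + e) → Fin K → ℤ), P (c + e) d v ε →
      ∀ (q : Equiv.Perm (Fin (c + e)) × (Fin (c + e) → Fin K)), termSign ε q ≠ 0 →
      ∀ r : Fin e ↪o Fin (c + e), (∀ i, r i ∉ (univ : Finset (Fin c)).image (fun j => q.1 (Fin.castAdd e j))) →
        P e d (fun i j l => v (r i) (Fin.natAdd c j) l) (fun i j l => ε (r i) (Fin.natAdd c j) l))
    (hvisit : ∀ (c e : ℕ) (d : Fin K → ℕ) (v ε : Fin (c + e) → Fin (c + e) → Fin K → ℤ), P (c + e) d v ε →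
      c = (c + e) / 2 → 2 ≤ c + e →
      ∀ (n : ℕ) (θ : Fin (n + 1) → ℤ) (p : Fin (n + 1) → Equiv.Perm (Fin (c + e)) × (Fin (c + e) → Fin K)),
        StrictMono θ → (∀ k, IsDominant d v ε (θ k) (p k)) → (∀ k : Fin n, p k.castSucc ≠ p k.succ) →
        ((univ : Finset (Fin (n + 1))).image fun k =>
          (univ : Finset (Fin c)).image fun j => (p k).1 (Fin.castAdd e j)).card ≤ S (c + e))
    (hG0 : K ≤ G 0) (hGmono : Monotone G)
    (hGstep : ∀ t m : ℕ, 2 ^ t < m → m ≤ 2 ^ (t + 1) → S m * (G t + G t + 1) ≤ G (t + 1) + 1) :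
    ∀ (t m : ℕ), m ≤ 2 ^ t → ∀ (d : Fin K → ℕ) (v ε : Fin m → Fin m → Fin K → ℤ), P m d v ε →
      DesignRowD d v ε (G t) := by
  classical
  intro t
  induction t with
  | zero =>
    intro m hm d v ε _
    have hm1 : m ≤ 1 := by simpa using hm
    rcases Nat.le_one_iff_eq_zero_or_eq_one.mp hm1 with rfl | rfl
    · exact designRowD_mono (Nat.zero_le _) (tropRowD_size_zero K 0 d v ε)
    · exact designRowD_mono (by omega) (tropRowD_one K d v ε)
  | succ t ih =>
    intro m hm d v ε hP
    by_cases hsmall : m ≤ 2 ^ t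
    · exact designRowD_mono (hGmono (Nat.le_succ t)) (ih m hsmall d v ε hP)
    have hmlarge : 2 ^ t < m := by omega
    have hm2 : 2 ≤ m := by
      have : 1 ≤ 2 ^ t := Nat.one_le_two_pow
      omega
    -- balanced split `m = c + e'`, `c = m / 2`
    obtain ⟨c, e', he, hc, hc2, he2⟩ : ∃ c e', c + e' = m ∧ c = m / 2 ∧ c ≤ 2 ^ t ∧ e' ≤ 2 ^ t := by
      refine ⟨m / 2, m - m / 2, by omega, rfl, ?_, ?_⟩
      · have : 2 ^ (t + 1) = 2 * 2 ^ t := by ring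
        omega
      · have : 2 ^ (t + 1) = 2 * 2 ^ t := by ring
        omega
    -- transport to the format `c + e'`
    apply designRowD_cast he d v ε
    have hP' := hcast m (c + e') he d v ε hP
    set v' : Fin (c + e') → Fin (c + e') → Fin K → ℤ := fun a b l => v (Fin.cast he a) (Fin.cast he b) l with hv'
    set ε' : Fin (c + e') → Fin (c + e') → Fin K → ℤ := fun a b l => ε (Fin.cast he a) (Fin.cast he b) l with hε'
    intro n θ p hθ hdom hne
    -- the visited states of this chain
    set 𝓡 := (univ : Finset (Fin (n + 1))).image fun k =>
      (univ : Finset (Fin c)).image fun j => (p k).1 (Fin.castAdd e' j) with h𝓡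
    have h𝓡card : ∀ R ∈ 𝓡, R.card = c := by
      intro R hR
      obtain ⟨k, _, rfl⟩ := mem_image.mp hR
      have hinj : Function.Injective fun j : Fin c => (p k).1 (Fin.castAdd e' j) :=
        (p k).1.injective.comp (Fin.castAdd_injective _ _)
      rw [card_image_of_injective _ hinj, card_univ, Fintype.card_fin]
    -- every visited state is the state of a present term (the chain term itself)
    have hpres : ∀ R ∈ 𝓡, ∃ q : Equiv.Perm (Fin (c + e')) × (Fin (c + e') → Fin K), termSign ε' q ≠ 0 ∧
        (univ : Finset (Fin c)).image (fun j => q.1 (Fin.castAdd e' j)) = R := by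
      intro R hR
      obtain ⟨k, _, rfl⟩ := mem_image.mp hR
      exact ⟨p k, (hdom k).1, rfl⟩
    have hsplit := chain_split d v' ε' 𝓡 h𝓡card (B₁ := G t) (B₂ := G t)
      (fun R hR r hr => by
        obtain ⟨q, hq, hqR⟩ := hpres R hR
        exact ih c hc2 d _ _ (hleft c e' d v' ε' hP' q hq r (fun i => hqR ▸ hr i)))
      (fun R hR r hr => by
        obtain ⟨q, hq, hqR⟩ := hpres R hR
        exact ih e' he2 d _ _ (hright c e' d v' ε' hP' q hq r (fun i => hqR ▸ hr i)))
      θ p hθ hdom hne (fun k => mem_image_of_mem _ (mem_univ k))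
    have hS : 𝓡.card ≤ S (c + e') :=
      hvisit c e' d v' ε' hP' (by omega) (by omega) n θ p hθ hdom hne
    have hstep := hGstep t (c + e') (by omega) (by omega)
    have h1 : n + 1 ≤ S (c + e') * (G t + G t + 1) :=
      hsplit.trans (Nat.mul_le_mul_right _ hS)
    omega

end Engine

/-! ## The engine's trivial instance: all designs, all `c`-subsets as states (= the halving recursion) -/

/-- **Sanity instance.**  With `P = everything` and `S m = C(m, m/2)` (every `c`-subset may be visited) the engine is the
halving recursion of `tropRowD_halving`; recorded to show the hypotheses are satisfiable and how a sector instantiates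
them (a sector replaces `S` by its own state count). [folklore] -/
theorem tropRowD_of_visitedStates_all {K : ℕ} (G : ℕ → ℕ) (hG0 : K ≤ G 0) (hGmono : Monotone G)
    (hGstep : ∀ t m : ℕ, 2 ^ t < m → m ≤ 2 ^ (t + 1) → m.choose (m / 2) * (G t + G t + 1) ≤ G (t + 1) + 1)
    (t m : ℕ) (hm : m ≤ 2 ^ t) : TropRowD m K (G t) := by
  classical
  intro d v ε
  refine designRowD_of_visitedStates (K := K) (fun _ _ _ _ => True) (fun m => m.choose (m / 2)) G
    (fun _ _ _ _ _ _ _ => trivial) (fun _ _ _ _ _ _ _ _ _ _ => trivial) (fun _ _ _ _ _ _ _ _ _ _ => trivial)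
    ?_ hG0 hGmono hGstep t m hm d v ε trivial
  intro c e d' v' ε' _ hc _ n θ p _ _ _
  -- the visited states are `c`-subsets of `Fin (c + e)`
  calc ((univ : Finset (Fin (n + 1))).image fun k =>
          (univ : Finset (Fin c)).image fun j => (p k).1 (Fin.castAdd e j)).card
      ≤ ((univ : Finset (Fin (c + e))).powersetCard c).card := by
        refine card_le_card fun R hR => ?_
        obtain ⟨k, _, rfl⟩ := mem_image.mp hR
        rw [mem_powersetCard]
        refine ⟨subset_univ _, ?_⟩
        have hinj : Function.Injective fun j : Fin c => (p k).1 (Fin.castAdd e j) :=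
          (p k).1.injective.comp (Fin.castAdd_injective _ _)
        rw [card_image_of_injective _ hinj, card_univ, Fintype.card_fin]
    _ = (c + e).choose ((c + e) / 2) := by rw [card_powersetCard, card_univ, Fintype.card_fin, ← hc]

end Summit.ValiantsHypothesis.ValiantsHypothesis.Theorems.KPlusLogSqLaw
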